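import Mathlib
import Summits.Ventures.PercRepro2.Defs
import Summits.Ventures.PercRepro2.Independence
import Summits.Ventures.PercRepro2.Harris
import Summits.Ventures.PercRepro2.CoinDefs
import Summits.Ventures.PercRepro2.CoinArcsOff
import Summits.Ventures.PercRepro2.CoinPendantDefs
import Summits.Ventures.PercRepro2.CoinPendant
import Summits.Ventures.PercRepro2.CoinPathDefs
import Summits.Ventures.PercRepro2.CoinTwoPendantDefs

/-!
# The trace levels of a GENERAL pendant set (blind cell PercRepro2, night-2 g3;
proofs/NIGHT2-DARC.md §17)

For a vertex set `P` and the target set `T`, the TRACE of a configuration is `Z = K⁻ ∩ P` (the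
vertices of `P` that reach `T`); `traceLevel arcs T P Z` is the event «the trace is `Z`».  The
levels `Z ∈ P.powerset` partition the configuration space, and by the trace identities of
`CoinTwoPendantDefs.lean`
* `R_T = ⊔_{Z ⊆ P} (traceLevel Z ∩ R^{D₀}_{Z ∪ T})` (`avoid_eq_biUnion_levels`, no hypothesis);
* for a closed-out `P ∋ w` and `u ∉ P ∪ T`,
  `gate(u → w) = ⊔_{Z ⊆ P} (traceLevel Z ∩ R^{D₀}_{gateTarget u w Z T})` with
  `gateTarget = Z ∪ T ∪ {u}` if `w ∈ Z`, `Z ∪ T` otherwise (`gate_eq_biUnion_levels`);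
* masses over such disjoint unions are sums over `P.powerset` (`massE_biUnion`), each piece
  FACTORISES when the pendant coins carry only arcs with tails in `P ∪ T` (`trace_piece`):
  `E[g; R_T] = Σ_Z ℓ_Z · E₀[f; R_{Z ∪ T}]` and `E[g; gate] = Σ_Z ℓ_Z · E₀[f; R_{gateTarget Z}]`
  (`trace_mass`, `ℓ_Z = P(traceLevel Z)`).
This is the `CoinTwoPendantMass.lean` machinery for an arbitrary pendant set, indexed by
`P.powerset` instead of four explicit levels; `CoinTraceTower.lean` adds the tower identity for
functionals of the trace.
-/

namespace Summit.Ventures.PercRepro2.Coin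

section Levels

open Classical

variable {V : Type*} {E : Type*} [DecidableEq V]

/-- The LEVEL of the trace `Z`: exactly the vertices of `Z` among those of `P` reach `T`. -/
def traceLevel (arcs : E → Finset (V × V)) (T P Z : Finset V) : Set (Config E) :=
  {ω | ∀ z ∈ P, z ∈ Z ↔ ω ∈ bwdEvent arcs z T}

/-- The avoided set of the gate piece on the level `Z`: `Z ∪ T` with `u` added when `w ∈ Z`. -/
def gateTarget (u w : V) (Z T : Finset V) : Finset V :=
  if w ∈ Z then insert u (Z ∪ T) else Z ∪ T

variable {arcs : E → Finset (V × V)} {T P : Finset V}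

omit [DecidableEq V] in
/-- Two levels meeting in a configuration are the same trace. -/
lemma traceLevel_eq_of_mem {Z Z' : Finset V} (hZ : Z ⊆ P) (hZ' : Z' ⊆ P) {ω : Config E}
    (h : ω ∈ traceLevel arcs T P Z) (h' : ω ∈ traceLevel arcs T P Z') : Z = Z' := by
  ext z
  constructor
  · intro hz; exact (h' z (hZ hz)).mpr ((h z (hZ hz)).mp hz)
  · intro hz; exact (h z (hZ' hz)).mpr ((h' z (hZ' hz)).mp hz)

omit [DecidableEq V] in
/-- Distinct traces have disjoint levels. -/
lemma disjoint_traceLevel {Z Z' : Finset V} (hZ : Z ⊆ P) (hZ' : Z' ⊆ P) (hne : Z ≠ Z') :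
    Disjoint (traceLevel arcs T P Z) (traceLevel arcs T P Z') :=
  Set.disjoint_left.2 fun _ h h' => hne (traceLevel_eq_of_mem hZ hZ' h h')

omit [DecidableEq V] in
/-- The trace of `ω` is `P.filter (· ∈ K⁻)`. -/
lemma mem_traceLevel_filter (ω : Config E) :
    ω ∈ traceLevel arcs T P (P.filter fun z => ω ∈ bwdEvent arcs z T) := by
  intro z hz
  simp only [Finset.mem_filter, hz, true_and]

/-- **`R_T` over the levels**: `R_T = ⊔_{Z ⊆ P} (traceLevel Z ∩ R^{D₀}_{Z ∪ T})`. -/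
theorem avoid_eq_biUnion_levels (arcs : E → Finset (V × V)) (s : V) (T P : Finset V) :
    avoidEvent arcs s T =
      ⋃ Z ∈ P.powerset, (traceLevel arcs T P Z ∩ avoidEvent (arcsOff arcs (P ∪ T)) s (Z ∪ T)) := by
  ext ω
  simp only [Set.mem_iUnion, Set.mem_inter_iff, Finset.mem_powerset, exists_prop]
  constructor
  · intro h
    exact ⟨_, Finset.filter_subset _ _, mem_traceLevel_filter ω,
      (avoid_iff_trace (Finset.filter_subset _ _) (mem_traceLevel_filter ω)).mp h⟩
  · rintro ⟨Z, hZ, hlev, hR⟩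
    exact (avoid_iff_trace hZ hlev).mpr hR

/-- On the level `Z`, the gate event of `u → w` is `R^{D₀}_{gateTarget u w Z T}`. -/
lemma gate_iff_level (hclosed : ClosedOut arcs P T) {s u w : V} (hu : u ∉ P ∪ T) (hw : w ∈ P)
    {Z : Finset V} (hZ : Z ⊆ P) {ω : Config E} (hlev : ω ∈ traceLevel arcs T P Z) :
    ω ∈ gateEvent arcs s T u w ↔
      ω ∈ avoidEvent (arcsOff arcs (P ∪ T)) s (gateTarget u w Z T) := by
  unfold gateTarget
  by_cases hwZ : w ∈ Z
  · rw [if_pos hwZ]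
    exact gate_iff_trace hclosed hu hZ hlev hw hwZ
  · rw [if_neg hwZ]
    have hnb : ω ∉ bwdEvent arcs w T := fun h => hwZ ((hlev w hw).mpr h)
    exact (gate_eq_avoid_of_not_bwd hnb).trans (avoid_iff_trace hZ hlev)

/-- **The gate event over the levels**: for a closed-out `P ∋ w` and `u ∉ P ∪ T`,
`gate(u → w) = ⊔_{Z ⊆ P} (traceLevel Z ∩ R^{D₀}_{gateTarget u w Z T})`. -/
theorem gate_eq_biUnion_levels (hclosed : ClosedOut arcs P T) (s : V) {u w : V}
    (hu : u ∉ P ∪ T) (hw : w ∈ P) :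
    gateEvent arcs s T u w =
      ⋃ Z ∈ P.powerset,
        (traceLevel arcs T P Z ∩ avoidEvent (arcsOff arcs (P ∪ T)) s (gateTarget u w Z T)) := by
  ext ω
  simp only [Set.mem_iUnion, Set.mem_inter_iff, Finset.mem_powerset, exists_prop]
  constructor
  · intro h
    exact ⟨_, Finset.filter_subset _ _, mem_traceLevel_filter ω,
      (gate_iff_level hclosed hu hw (Finset.filter_subset _ _) (mem_traceLevel_filter ω)).mp h⟩
  · rintro ⟨Z, hZ, hlev, hR⟩
    exact (gate_iff_level hclosed hu hw hZ hlev).mpr hR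

omit [DecidableEq V] in
/-- The level pieces are pairwise disjoint (whatever the second factors), over any family of
traces inside `P`. -/
lemma pairwiseDisjoint_levels {S : Finset (Finset V)} (hS : ∀ Z ∈ S, Z ⊆ P)
    (A : Finset V → Set (Config E)) :
    (↑S : Set (Finset V)).PairwiseDisjoint (fun Z => traceLevel arcs T P Z ∩ A Z) := by
  intro Z hZ Z' hZ' hne
  exact Set.disjoint_of_subset Set.inter_subset_left Set.inter_subset_left
    (disjoint_traceLevel (hS Z hZ) (hS Z' hZ') hne)

omit [DecidableEq V] in
/-- The level pieces over `P.powerset` are pairwise disjoint. -/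
lemma pairwiseDisjoint_levels_powerset (A : Finset V → Set (Config E)) :
    (↑P.powerset : Set (Finset V)).PairwiseDisjoint
      (fun Z => traceLevel arcs T P Z ∩ A Z) :=
  pairwiseDisjoint_levels (fun _ hZ => Finset.mem_powerset.mp hZ) A

/-- The levels depend on the pendant coins only (closed-out `P`). -/
lemma dependsOn_traceLevel (hclosed : ClosedOut arcs P T) (Z : Finset V) :
    DependsOn (· ∈ traceLevel arcs T P Z) (tailCoins arcs P) := by
  intro ω ω' h
  have hb : ∀ z ∈ P, (ω ∈ bwdEvent arcs z T ↔ ω' ∈ bwdEvent arcs z T) := fun z hz =>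
    dependsOn_mem_iff (dependsOn_bwdEvent_pendant arcs hclosed hz) h
  simp only [traceLevel, Set.mem_setOf_eq]
  exact propext (forall_congr' fun z => forall_congr' fun hz => by rw [hb z hz])

end Levels

section Mass

open Classical

variable {E : Type*} [Fintype E] [DecidableEq E] {R : Type*} [CommRing R]

/-- `expect` of a finite sum of observables. -/
lemma expect_finset_sum {ι : Type*} (p : E → R) (S : Finset ι) (g : ι → Config E → R) :
    expect p (fun ω => ∑ i ∈ S, g i ω) = ∑ i ∈ S, expect p (g i) := by
  unfold expect
  simp only [Finset.mul_sum]
  exact Finset.sum_comm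

/-- The mass of a pairwise disjoint finite union is the sum of the masses. -/
lemma massE_biUnion {ι : Type*} (p : E → R) (f : Config E → R) (S : Finset ι)
    (A : ι → Set (Config E)) (h : (↑S : Set ι).PairwiseDisjoint A) :
    massE p f (⋃ i ∈ S, A i) = ∑ i ∈ S, massE p f (A i) := by
  unfold massE
  rw [Finset.indicator_biUnion S A h]
  exact expect_finset_sum p S fun i => (A i).indicator f

end Mass

section Factor

open Classical

variable {V : Type*} {E : Type*} [DecidableEq V] [Fintype E] [DecidableEq E] {R : Type*} [Field R]

/-- The factorisation of a mass over a level piece (general pendant set): for a level event `L`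
depending on the pendant coins and an integrand depending on the other coins,
`E[g; L ∩ R^{D₀}_X] = P(L) · E[f; R^{D₀}_X]` whenever `g = f` on the piece. -/
lemma trace_piece (p : E → R) {arcs : E → Finset (V × V)} {P T : Finset V}
    (hT : TailCoinsIn arcs P T) {L : Set (Config E)}
    (hL : DependsOn (· ∈ L) (tailCoins arcs P)) (s : V) (X : Finset V)
    {f g : Config E → R} (hf : DependsOn f (tailCoins arcs P)ᶜ)
    (hg : ∀ ω ∈ L ∩ avoidEvent (arcsOff arcs (P ∪ T)) s X, g ω = f ω) :
    massE p g (L ∩ avoidEvent (arcsOff arcs (P ∪ T)) s X) =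
      prob p L * massE p f (avoidEvent (arcsOff arcs (P ∪ T)) s X) := by
  have hcongr : ∀ ω ω' : Config E, (∀ e ∈ (tailCoins arcs P)ᶜ, ω e = ω' e) →
      ∀ e, arcsOff arcs (P ∪ T) e ≠ ∅ → ω e = ω' e := by
    intro ω ω' h e he
    by_cases hmem : e ∈ tailCoins arcs P
    · exact absurd (arcsOff_eq_empty_of_tailCoins hT hmem) he
    · exact h e hmem
  have hdep : DependsOn ((avoidEvent (arcsOff arcs (P ∪ T)) s X).indicator f)
      (tailCoins arcs P)ᶜ := by
    intro ω ω' h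
    have hreach : ∀ x y, Reach (arcsOff arcs (P ∪ T)) ω x y ↔
        Reach (arcsOff arcs (P ∪ T)) ω' x y :=
      fun x y => reach_arcsOff_congr (hcongr ω ω' h)
    have hmem : ω ∈ avoidEvent (arcsOff arcs (P ∪ T)) s X ↔
        ω' ∈ avoidEvent (arcsOff arcs (P ∪ T)) s X := by
      simp only [avoidEvent, Set.mem_setOf_eq, hreach]
    by_cases hω : ω ∈ avoidEvent (arcsOff arcs (P ∪ T)) s X
    · rw [Set.indicator_of_mem hω, Set.indicator_of_mem (hmem.mp hω)]; exact hf h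
    · rw [Set.indicator_of_notMem hω, Set.indicator_of_notMem (fun h' => hω (hmem.mpr h'))]
  rw [massE_congr' p hg]
  exact massE_inter_of_dependsOn' p (tailCoins arcs P) L hL f _ hdep

omit [Fintype E] [DecidableEq E] in
/-- The reduced markers depend on the non-pendant coins. -/
lemma trace_dependsOn_marker {arcs : E → Finset (V × V)} {P T : Finset V}
    (hT : TailCoinsIn arcs P T) (s a : V) :
    DependsOn (marker (R := R) (arcsOff arcs (P ∪ T)) s a) (tailCoins arcs P)ᶜ := by
  intro ω ω' h
  have hcongr : ∀ e, arcsOff arcs (P ∪ T) e ≠ ∅ → ω e = ω' e := by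
    intro e he
    by_cases hmem : e ∈ tailCoins arcs P
    · exact absurd (arcsOff_eq_empty_of_tailCoins hT hmem) he
    · exact h e hmem
  have hr : Reach (arcsOff arcs (P ∪ T)) ω s a ↔ Reach (arcsOff arcs (P ∪ T)) ω' s a :=
    reach_arcsOff_congr hcongr
  simp only [marker, hr]

/-- **The mass decomposition over the levels** (general pendant set): for `f` depending on the
non-pendant coins and `g = f` on `R_T`,
`E[g; R_T] = Σ_{Z ⊆ P} ℓ_Z · E[f; R^{D₀}_{Z ∪ T}]` and
`E[g; gate] = Σ_{Z ⊆ P} ℓ_Z · E[f; R^{D₀}_{gateTarget u w Z T}]`. -/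
theorem trace_mass (p : E → R) {arcs : E → Finset (V × V)} {P T : Finset V}
    (hclosed : ClosedOut arcs P T) (hT : TailCoinsIn arcs P T) (s : V) {u w : V}
    (hu : u ∉ P ∪ T) (hw : w ∈ P) {f g : Config E → R}
    (hf : DependsOn f (tailCoins arcs P)ᶜ) (hg : ∀ ω ∈ avoidEvent arcs s T, g ω = f ω) :
    massE p g (avoidEvent arcs s T) =
      ∑ Z ∈ P.powerset, prob p (traceLevel arcs T P Z) *
        massE p f (avoidEvent (arcsOff arcs (P ∪ T)) s (Z ∪ T)) ∧
    massE p g (gateEvent arcs s T u w) =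
      ∑ Z ∈ P.powerset, prob p (traceLevel arcs T P Z) *
        massE p f (avoidEvent (arcsOff arcs (P ∪ T)) s (gateTarget u w Z T)) := by
  have hRT := avoid_eq_biUnion_levels arcs s T P
  have hG := gate_eq_biUnion_levels (arcs := arcs) hclosed s hu hw
  -- every gate piece lies in `R_T`
  have hsubG : ∀ Z ∈ P.powerset,
      traceLevel arcs T P Z ∩ avoidEvent (arcsOff arcs (P ∪ T)) s (gateTarget u w Z T) ⊆
        avoidEvent arcs s T := by
    intro Z hZ ω hω
    rw [hRT]
    simp only [Set.mem_iUnion, Set.mem_inter_iff, exists_prop]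
    refine ⟨Z, hZ, hω.1, fun t' ht' hr => hω.2 t' ?_ hr⟩
    unfold gateTarget
    split_ifs
    · exact Finset.mem_insert_of_mem ht'
    · exact ht'
  have hsubR : ∀ Z ∈ P.powerset,
      traceLevel arcs T P Z ∩ avoidEvent (arcsOff arcs (P ∪ T)) s (Z ∪ T) ⊆
        avoidEvent arcs s T := by
    intro Z hZ ω hω
    rw [hRT]
    simp only [Set.mem_iUnion, Set.mem_inter_iff, exists_prop]
    exact ⟨Z, hZ, hω⟩
  constructor
  · rw [hRT, massE_biUnion p g _ _ (pairwiseDisjoint_levels_powerset _)]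
    refine Finset.sum_congr rfl fun Z hZ => ?_
    exact trace_piece p hT (dependsOn_traceLevel hclosed Z) s _ hf
      fun ω hω => hg ω (hsubR Z hZ hω)
  · rw [hG, massE_biUnion p g _ _ (pairwiseDisjoint_levels_powerset _)]
    refine Finset.sum_congr rfl fun Z hZ => ?_
    exact trace_piece p hT (dependsOn_traceLevel hclosed Z) s _ hf
      fun ω hω => hg ω (hsubG Z hZ hω)

end Factor

end Summit.Ventures.PercRepro2.Coin
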